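import Summits.CriticalPhenomena.PercolationContinuityZ3.Theorems.PercNearOneGluingNoHeavyQuantIndepBlobGapPairs
import HarnessLib

/-!
# QUANT lane R8, the gap calculus: the LIGHT-PAIR extension lemma — two sub-floor blobs whose odds multiply to the floor's odds
# add twice the smaller size to the gap parameter (no heavy companion needed)

builds on p205010 (kernel theorem, internal audit signed; external expert review pending)

Support file (`--supports stmt-CriticalPhenomena-4575`), QUANT lane seat prim-quant-p1 (gen 11); memo
`run/shared/lean/prim/quant/P1-SURPLUS.md` §22.8.  Theorems only; no definitions, no sorries, standard axioms.  Vocabulary and tools of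
lead g16's gap calculus (`…QuantIndepBlobGapCalculus`, `…QuantIndepBlobGapPairs`: restricted tails `TL_U`, the gap property
`x ≤ x·TL_U(y) + (1 − x)·TL_U(v)` for `y ≤ v`, `y + v ≤ E + 1`, `gapFun_extend`, `gapFun_shift`, `tail_ge_of_gapCert`).

Lead g16's pair lemma (`IndepBlob.gap_insert_pair`, LEAD-NOTES-G16 N31) pairs a light blob with a HEAVY companion of at least its size.
The residual family of the DIB\* corner found by this seat (P1-SURPLUS §22.2: two or three near-giant blobs JUST BELOW the floor, e.g.
`x = .893`, `j = 1`, heavy `(1, .894)`, lights `(1, .878), (1, .837)`) has no such companion: its mechanism is that TWO LIGHT flips pay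
for one transport step (`odds(g₁)·odds(g₂) ≥ odds(x)`).  This file makes that a lemma of the calculus:

* `IndepBlob.lightPairDecomp` — the law of two independent blobs `(b, g₁)`, `(B, g₂)` with `x(1−g₁)(1−g₂) ≤ (1−x)g₁g₂` is the convex
  combination `W₁·[floor blob of size b+B] + W₂·[sure b] + W₃·[sure B] + W₄·[sure b+B]`, `W₁ = (1−g₁)(1−g₂)/(1−x)`, `W₂ = g₁(1−g₂)`,
  `W₃ = (1−g₁)g₂`, `W₄ = g₁g₂ − xW₁ ≥ 0` (⟺ the odds condition);
* `IndepBlob.gap_insert_lightPair` — hence `GAP(U, E) ⟹ GAP(U + ℓ₁ + ℓ₂, E + 2·a ℓ₁)` for ANY two blobs (no floor condition on either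
  gate) with `a ℓ₁ ≤ a ℓ₂` and `x(1 − p ℓ₁)(1 − p ℓ₂) ≤ (1 − x)·p ℓ₁·p ℓ₂`, floor `1/2 ≤ x < 1` (each component has the gap property at
  `E + 2·a ℓ₁` by `gapFun_extend` / `gapFun_shift`, and GAP is convex in the law);
* `IndepBlob.tail_ge_of_lightPair` — **the light-pair row**: all blobs heavy except two such blobs `ℓ₁, ℓ₂`, and
  `2j + 1 + a ℓ₂ ≤ Σ a + a ℓ₁` (the pair counts at twice its smaller size) ⟹ `x ≤ P(N ≥ j+1)` (`tail_ge_of_gapCert` with `S = {ℓ₁, ℓ₂}`).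
  With both light gates `≥ √x/(√x + √(1−x))` the odds condition is automatic; the three-unit instance above is certified (`1 + 2 ≥ 3`).
[cite: KozmaNitzan2024, Conjecture 3 (p. 15)] (the gluing rows served); the lemma is [this work].
-/

namespace Summit.CriticalPhenomena.PercolationContinuityZ3.Theorems

namespace Quant

namespace IndepBlob

open Finset

variable {κ : Type*} [DecidableEq κ]

/-- **The four-component decomposition of a light pair** (pure algebra).  For `x < 1` and gates `g₁, g₂ ∈ [0,1]` with
`x(1 − g₁)(1 − g₂) ≤ (1 − x)·g₁·g₂` there are weights `W₁, …, W₄ ≥ 0`, summing to `1`, with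
`g₂(g₁ z₃ + (1−g₁) z₂) + (1−g₂)(g₁ z₁ + (1−g₁) z₀) = W₁(x z₃ + (1−x) z₀) + W₂ z₁ + W₃ z₂ + W₄ z₃` identically:
`W₁ = (1−g₁)(1−g₂)/(1−x)`, `W₂ = g₁(1−g₂)`, `W₃ = (1−g₁)g₂`, `W₄ = g₁g₂ − x·W₁`. [this work] -/
theorem lightPairDecomp (x g₁ g₂ : ℝ) (hx1 : x < 1) (hg₁0 : 0 ≤ g₁) (hg₁1 : g₁ ≤ 1) (hg₂0 : 0 ≤ g₂) (hg₂1 : g₂ ≤ 1)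
    (hodds : x * (1 - g₁) * (1 - g₂) ≤ (1 - x) * g₁ * g₂) :
    ∃ W₁ W₂ W₃ W₄ : ℝ, 0 ≤ W₁ ∧ 0 ≤ W₂ ∧ 0 ≤ W₃ ∧ 0 ≤ W₄ ∧ W₁ + W₂ + W₃ + W₄ = 1 ∧
      ∀ z₀ z₁ z₂ z₃ : ℝ, g₂ * (g₁ * z₃ + (1 - g₁) * z₂) + (1 - g₂) * (g₁ * z₁ + (1 - g₁) * z₀) =
        W₁ * (x * z₃ + (1 - x) * z₀) + W₂ * z₁ + W₃ * z₂ + W₄ * z₃ := by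
  have h1x : 0 < 1 - x := by linarith
  refine ⟨(1 - g₁) * (1 - g₂) / (1 - x), g₁ * (1 - g₂), (1 - g₁) * g₂, g₁ * g₂ - x * ((1 - g₁) * (1 - g₂) / (1 - x)),
    div_nonneg (mul_nonneg (by linarith) (by linarith)) h1x.le, mul_nonneg hg₁0 (by linarith), mul_nonneg (by linarith) hg₂0, ?_, ?_, ?_⟩
  · -- `W₄ ≥ 0` is the odds condition
    rw [sub_nonneg, ← mul_div_assoc, div_le_iff₀ h1x]
    nlinarith
  · field_simp
    ring
  · intro z₀ z₁ z₂ z₃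
    have e : (1 - x) * ((1 - g₁) * (1 - g₂) / (1 - x)) = (1 - g₁) * (1 - g₂) := by field_simp
    have e' : (1 - g₁) * (1 - g₂) / (1 - x) * ((1 - x) * z₀) = (1 - g₁) * (1 - g₂) * z₀ := by
      rw [← mul_assoc, mul_comm ((1 - g₁) * (1 - g₂) / (1 - x)) (1 - x), e]
    calc g₂ * (g₁ * z₃ + (1 - g₁) * z₂) + (1 - g₂) * (g₁ * z₁ + (1 - g₁) * z₀)
        = g₁ * g₂ * z₃ + (1 - g₁) * g₂ * z₂ + g₁ * (1 - g₂) * z₁ + (1 - g₁) * (1 - g₂) * z₀ := by ring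
      _ = (1 - g₁) * (1 - g₂) / (1 - x) * (x * z₃) + (1 - g₁) * (1 - g₂) / (1 - x) * ((1 - x) * z₀) +
            g₁ * (1 - g₂) * z₁ + (1 - g₁) * g₂ * z₂ + (g₁ * g₂ - x * ((1 - g₁) * (1 - g₂) / (1 - x))) * z₃ := by
          rw [e']; ring
      _ = _ := by ring

/-- **THE LIGHT-PAIR EXTENSION LEMMA.**  Gates in `[0,1]` on `U`, floor `1/2 ≤ x < 1`; `U` has the gap property at `E`; two further
blobs `ℓ₁ ≠ ℓ₂` (not in `U`, ANY gates in `[0,1]`) with `a ℓ₁ ≤ a ℓ₂` and `x(1 − p ℓ₁)(1 − p ℓ₂) ≤ (1 − x)·p ℓ₁·p ℓ₂`.  Then `U + ℓ₁ + ℓ₂`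
has the gap property at `E + 2·a ℓ₁`.  Proof: with `b = a ℓ₁ ≤ B = a ℓ₂`, `T = TL_U`,
`TL(t) = g₂(g₁T(t−B−b) + (1−g₁)T(t−B)) + (1−g₂)(g₁T(t−b) + (1−g₁)T(t))` is by `lightPairDecomp` a convex combination of
`xT(t−(B+b)) + (1−x)T(t)` (floor blob of size `B+b`: gap `E+B+b ≥ E+2b`), `T(t−b)` (`E+2b`), `T(t−B)` (`E+2B`), `T(t−B−b)`. [this work] -/
theorem gap_insert_lightPair (p : κ → ℝ) (a : κ → ℕ) (x : ℝ) (hx : 1 / 2 ≤ x) (hx1 : x < 1) (U : Finset κ)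
    (hp0 : ∀ i ∈ U, 0 ≤ p i) (hp1 : ∀ i ∈ U, p i ≤ 1) (ℓ₁ ℓ₂ : κ) (hℓ₁ : ℓ₁ ∉ U) (hℓ₂ : ℓ₂ ∉ U) (hne : ℓ₁ ≠ ℓ₂)
    (hg₁0 : 0 ≤ p ℓ₁) (hg₁1 : p ℓ₁ ≤ 1) (hg₂0 : 0 ≤ p ℓ₂) (hg₂1 : p ℓ₂ ≤ 1) (hbB : a ℓ₁ ≤ a ℓ₂)
    (hodds : x * (1 - p ℓ₁) * (1 - p ℓ₂) ≤ (1 - x) * p ℓ₁ * p ℓ₂) (E : ℕ)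
    (hU : ∀ y v : ℕ, y ≤ v → y + v ≤ E + 1 →
      x ≤ x * (∑ s ∈ U.powerset, (∏ i ∈ U, (if i ∈ s then p i else 1 - p i)) *
              (if y ≤ ∑ i ∈ s, a i then (1 : ℝ) else 0)) +
          (1 - x) * (∑ s ∈ U.powerset, (∏ i ∈ U, (if i ∈ s then p i else 1 - p i)) *
              (if v ≤ ∑ i ∈ s, a i then (1 : ℝ) else 0))) :
    ∀ y v : ℕ, y ≤ v → y + v ≤ E + 2 * a ℓ₁ + 1 →
      x ≤ x * (∑ s ∈ (insert ℓ₂ (insert ℓ₁ U)).powerset,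
              (∏ i ∈ insert ℓ₂ (insert ℓ₁ U), (if i ∈ s then p i else 1 - p i)) *
              (if y ≤ ∑ i ∈ s, a i then (1 : ℝ) else 0)) +
          (1 - x) * (∑ s ∈ (insert ℓ₂ (insert ℓ₁ U)).powerset,
              (∏ i ∈ insert ℓ₂ (insert ℓ₁ U), (if i ∈ s then p i else 1 - p i)) *
              (if v ≤ ∑ i ∈ s, a i then (1 : ℝ) else 0)) := by
  intro y v hyv hsum
  have hℓ₂U : ℓ₂ ∉ insert ℓ₁ U := by
    rw [Finset.mem_insert]; exact fun h => h.elim (fun h' => hne h'.symm) hℓ₂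
  rw [tailU_insert p a (insert ℓ₁ U) ℓ₂ hℓ₂U y, tailU_insert p a (insert ℓ₁ U) ℓ₂ hℓ₂U v,
    tailU_insert p a U ℓ₁ hℓ₁ (y - a ℓ₂), tailU_insert p a U ℓ₁ hℓ₁ y,
    tailU_insert p a U ℓ₁ hℓ₁ (v - a ℓ₂), tailU_insert p a U ℓ₁ hℓ₁ v]
  set T : ℕ → ℝ := fun t => ∑ s ∈ U.powerset, (∏ i ∈ U, (if i ∈ s then p i else 1 - p i)) *
      (if t ≤ ∑ i ∈ s, a i then (1 : ℝ) else 0) with hT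
  have hT0 : T 0 = 1 := by simp only [hT]; exact tailU_zero p a U
  have hTnn : ∀ t, 0 ≤ T t := fun t => by simp only [hT]; exact tailU_nonneg p a U hp0 hp1 t
  have hTanti : ∀ t t' : ℕ, t ≤ t' → T t' ≤ T t := fun t t' htt => by
    simp only [hT]; exact tailU_antitone p a U hp0 hp1 htt
  have hU' : ∀ y v : ℕ, y ≤ v → y + v ≤ E + 1 → x ≤ x * T y + (1 - x) * T v := fun y v h1 h2 => by
    simp only [hT]; exact hU y v h1 h2
  set g₁ := p ℓ₁ with hg₁
  set g₂ := p ℓ₂ with hg₂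
  set b := a ℓ₁ with hb
  set B := a ℓ₂ with hB
  have hsub : ∀ t : ℕ, t - B - b = t - (B + b) := fun t => by omega
  change x ≤ x * (g₂ * (g₁ * T (y - B - b) + (1 - g₁) * T (y - B)) + (1 - g₂) * (g₁ * T (y - b) + (1 - g₁) * T y)) +
    (1 - x) * (g₂ * (g₁ * T (v - B - b) + (1 - g₁) * T (v - B)) + (1 - g₂) * (g₁ * T (v - b) + (1 - g₁) * T v))
  rw [hsub y, hsub v]
  have hx1' : x ≤ 1 := hx1.le
  -- the four component inequalities at the pair (y, v)
  have C1 : x ≤ x * (x * T (y - (B + b)) + (1 - x) * T y) + (1 - x) * (x * T (v - (B + b)) + (1 - x) * T v) :=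
    gapFun_extend x hx T hT0 hTnn hTanti E hU' x le_rfl hx1' (B + b) y v hyv (by omega)
  have C2 : x ≤ x * T (y - b) + (1 - x) * T (v - b) := gapFun_shift x hx1' T hT0 hTnn E hU' b y v hyv (by omega)
  have C3 : x ≤ x * T (y - B) + (1 - x) * T (v - B) := gapFun_shift x hx1' T hT0 hTnn E hU' B y v hyv (by omega)
  have C4 : x ≤ x * T (y - (B + b)) + (1 - x) * T (v - (B + b)) :=
    gapFun_shift x hx1' T hT0 hTnn E hU' (B + b) y v hyv (by omega)
  -- decompose and combine
  obtain ⟨W₁, W₂, W₃, W₄, hW₁, hW₂, hW₃, hW₄, hsumW, hdec⟩ :=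
    lightPairDecomp x g₁ g₂ hx1 hg₁0 hg₁1 hg₂0 hg₂1 hodds
  rw [hdec (T y) (T (y - b)) (T (y - B)) (T (y - (B + b))), hdec (T v) (T (v - b)) (T (v - B)) (T (v - (B + b)))]
  have hc1 := mul_le_mul_of_nonneg_left C1 hW₁
  have hc2 := mul_le_mul_of_nonneg_left C2 hW₂
  have hc3 := mul_le_mul_of_nonneg_left C3 hW₃
  have hc4 := mul_le_mul_of_nonneg_left C4 hW₄
  have hid : x * (W₁ * (x * T (y - (B + b)) + (1 - x) * T y) + W₂ * T (y - b) + W₃ * T (y - B) + W₄ * T (y - (B + b))) +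
      (1 - x) * (W₁ * (x * T (v - (B + b)) + (1 - x) * T v) + W₂ * T (v - b) + W₃ * T (v - B) + W₄ * T (v - (B + b))) =
      W₁ * (x * (x * T (y - (B + b)) + (1 - x) * T y) + (1 - x) * (x * T (v - (B + b)) + (1 - x) * T v)) +
      W₂ * (x * T (y - b) + (1 - x) * T (v - b)) + W₃ * (x * T (y - B) + (1 - x) * T (v - B)) +
      W₄ * (x * T (y - (B + b)) + (1 - x) * T (v - (B + b))) := by ring
  have hxs : x = W₁ * x + W₂ * x + W₃ * x + W₄ * x := by linear_combination (-x) * hsumW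
  rw [hid]
  linarith [hc1, hc2, hc3, hc4, hxs]

/-- **The light-pair row.**  Gates in `[0,1]`, floor `1/2 ≤ x < 1`; two blobs `ℓ₁ ≠ ℓ₂` with `a ℓ₁ ≤ a ℓ₂` and
`x(1 − p ℓ₁)(1 − p ℓ₂) ≤ (1 − x)·p ℓ₁·p ℓ₂` (ANY gates — e.g. two blobs just below the floor), every OTHER blob heavy (`x ≤ p k`), and
`2j + 1 + a ℓ₂ ≤ Σ a + a ℓ₁` (the pair counts at twice its smaller size, the rest at full size).  Then `x ≤ P(N ≥ j+1)`. [this work] -/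
theorem tail_ge_of_lightPair [Fintype κ] (p : κ → ℝ) (a : κ → ℕ) (x : ℝ) (hx : 1 / 2 ≤ x) (hx1 : x < 1)
    (hp0 : ∀ i, 0 ≤ p i) (hp1 : ∀ i, p i ≤ 1) (ℓ₁ ℓ₂ : κ) (hne : ℓ₁ ≠ ℓ₂) (hbB : a ℓ₁ ≤ a ℓ₂)
    (hodds : x * (1 - p ℓ₁) * (1 - p ℓ₂) ≤ (1 - x) * p ℓ₁ * p ℓ₂)
    (hheavy : ∀ k, k ≠ ℓ₁ → k ≠ ℓ₂ → x ≤ p k) (j : ℕ)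
    (hsize : 2 * j + 1 + a ℓ₂ ≤ (∑ k, a k) + a ℓ₁) :
    x ≤ ∑ s : Finset κ, (∏ i, (if i ∈ s then p i else 1 - p i)) * (if j + 1 ≤ ∑ i ∈ s, a i then (1 : ℝ) else 0) := by
  set S : Finset κ := insert ℓ₂ (insert ℓ₁ (∅ : Finset κ)) with hS
  have hℓ₁e : ℓ₁ ∉ (∅ : Finset κ) := Finset.notMem_empty _
  have hℓ₂e : ℓ₂ ∉ (∅ : Finset κ) := Finset.notMem_empty _
  -- `GAP(∅, 0)`
  have h0 : ∀ y v : ℕ, y ≤ v → y + v ≤ 0 + 1 →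
      x ≤ x * (∑ s ∈ (∅ : Finset κ).powerset, (∏ i ∈ (∅ : Finset κ), (if i ∈ s then p i else 1 - p i)) *
              (if y ≤ ∑ i ∈ s, a i then (1 : ℝ) else 0)) +
          (1 - x) * (∑ s ∈ (∅ : Finset κ).powerset, (∏ i ∈ (∅ : Finset κ), (if i ∈ s then p i else 1 - p i)) *
              (if v ≤ ∑ i ∈ s, a i then (1 : ℝ) else 0)) := by
    intro y v hyv hsum
    have hy : y = 0 := by omega
    subst hy
    rw [tailU_zero p a ∅]
    have hnn := tailU_nonneg p a (∅ : Finset κ) (fun i _ => hp0 i) (fun i _ => hp1 i) v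
    nlinarith [mul_nonneg (sub_nonneg.mpr hx1.le) hnn]
  have hpair := gap_insert_lightPair p a x hx hx1 ∅ (fun i _ => hp0 i) (fun i _ => hp1 i) ℓ₁ ℓ₂ hℓ₁e hℓ₂e hne
    (hp0 ℓ₁) (hp1 ℓ₁) (hp0 ℓ₂) (hp1 ℓ₂) hbB hodds 0 h0
  -- the mass off `S`
  have hSc : (∑ k ∈ Sᶜ, a k) + a ℓ₁ + a ℓ₂ = ∑ k, a k := by
    have h1 : ∑ k ∈ S, a k = a ℓ₂ + a ℓ₁ := by
      rw [hS, Finset.sum_insert (by simpa using fun h => hne h.symm), Finset.sum_insert hℓ₁e, Finset.sum_empty, add_zero]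
    have h2 := Finset.sum_add_sum_compl S a
    rw [h1] at h2
    linarith
  refine tail_ge_of_gapCert p a x hx hx1.le hp0 hp1 S (fun k hk => ?_) j (fun y v hyv hsum => ?_)
  · have hk1 : k ≠ ℓ₁ := fun h => hk (by rw [h, hS]; simp)
    have hk2 : k ≠ ℓ₂ := fun h => hk (by rw [h, hS]; simp)
    exact hheavy k hk1 hk2
  · exact hpair y v hyv (by omega)

end IndepBlob

end Quant

end Summit.CriticalPhenomena.PercolationContinuityZ3.Theorems
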